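import Summits.AtomisticToContinuum.FouriersLaw.Theorems.OddSectorIrreversibilityOddCorrectorDecayCurrentVarianceB
import Summits.AtomisticToContinuum.FouriersLaw.Theorems.OddSectorIrreversibilityOddCorrectorDecayCurrentVarianceC

/-!
# Extensivity of the current's `L²(Gibbs)` norm, IV: `∫ J² e^{-H/T} ≥ (T³/(4K)) (N - 2) ∫ e^{-H/T}`

Support file for item `stmt-AtomisticToContinuum-9139` (`OddSectorIrreversibility.OddCorrectorDecay`), negative
side — the static input `M_N ≥ c (N - 2) Z_N` of the bath-locality estimate, assembled from parts I–III.
* `pinnedChain_integral_force_sq_le` — `∫ (∂_iH)² e^{-H/T} ≤ K ∫ e^{-H/T}` with `K` depending only on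
  `ω₂, lam, β, T` (one-site moments);
* `pinnedChain_integral_totalCurrent_sq_ge_of_force` — abstract assembly: a uniform force-moment bound `K` gives
  `(T³/(4K)) (N - 2) Z_N ≤ ∫ J² e^{-H/T}` (`‖J‖² = T∑‖c_m‖²`, `c_m² ≥ (q_{m+1} - q_{m-1})²/4`, spread bound);
* `pinnedChain_integral_totalCurrent_sq_ge` — **`∫ J² e^{-H/T} ≥ (T³/(4K)) (N - 2) ∫ e^{-H/T}`** for `N ≥ 3`.
-/

noncomputable section

open MeasureTheory Finset Set
open scoped ENNReal
open Literature.MathematicalPhysics.KineticTheory.HeatConduction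
open Summit.AtomisticToContinuum.FouriersLaw.Theorems.SubdiffusiveBondHeat

namespace Summit.AtomisticToContinuum.FouriersLaw.Theorems.ChainVariation

variable {N : ℕ}

/-! ### Integrated force bound and the assembly -/

section Assembly

variable {ω₂ lam β : ℝ} (hω : 0 < ω₂) (hl : 0 ≤ lam) (hβ : 0 ≤ β) (γ : ℝ) {T : ℝ} (hT : 0 < T)
include hω hl hβ hT

omit hT in
/-- `q_k² ≤ (2/ω₂)(1 + H)` and `q_k⁶ ≤ (2/ω₂)³ (1 + H)⁴`. [folklore] -/
theorem pinnedChain_coord_pow_le (N : ℕ) (x : PhaseSpace N) (k : Fin N) :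
    x.1 k ^ 2 ≤ 2 * ω₂⁻¹ * (1 + (pinnedChain ω₂ lam β γ).hamiltonian N x) ∧
      x.1 k ^ 6 ≤ (2 * ω₂⁻¹) ^ 3 * (1 + (pinnedChain ω₂ lam β γ).hamiltonian N x) ^ 4 := by
  have h := pinnedChain_harmonic_le_hamiltonian (ω₂ := ω₂) hl hβ γ N x
  have h1 : ω₂ * x.1 k ^ 2 / 2 ≤ ∑ i, ω₂ * x.1 i ^ 2 / 2 :=
    Finset.single_le_sum (f := fun i => ω₂ * x.1 i ^ 2 / 2) (fun i _ => by positivity) (Finset.mem_univ k)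
  have h2 : 0 ≤ ∑ i, x.2 i ^ 2 / 2 := Finset.sum_nonneg fun i _ => by positivity
  set H := (pinnedChain ω₂ lam β γ).hamiltonian N x
  have hH : ω₂ * x.1 k ^ 2 / 2 ≤ H := by linarith
  have hH0 : 0 ≤ H := pinnedChain_hamiltonian_nonneg hω.le hl hβ γ N x
  have hq2 : x.1 k ^ 2 ≤ 2 * ω₂⁻¹ * H := by
    calc x.1 k ^ 2 = 2 * ω₂⁻¹ * (ω₂ * x.1 k ^ 2 / 2) := by field_simp
      _ ≤ 2 * ω₂⁻¹ * H := mul_le_mul_of_nonneg_left hH (by positivity)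
  have hq2' : x.1 k ^ 2 ≤ 2 * ω₂⁻¹ * (1 + H) := hq2.trans (by nlinarith [inv_pos.2 hω])
  refine ⟨hq2', ?_⟩
  have h0 : 0 ≤ x.1 k ^ 2 := sq_nonneg _
  calc x.1 k ^ 6 = (x.1 k ^ 2) ^ 3 := by ring
    _ ≤ (2 * ω₂⁻¹ * (1 + H)) ^ 3 := pow_le_pow_left₀ h0 hq2' 3
    _ = (2 * ω₂⁻¹) ^ 3 * (1 + H) ^ 3 := by ring
    _ ≤ (2 * ω₂⁻¹) ^ 3 * (1 + H) ^ 4 := by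
        refine mul_le_mul_of_nonneg_left ?_ (by positivity)
        exact pow_le_pow_right₀ (by linarith) (by norm_num)

/-- `(a q_k² + b q_k⁶) e^{-H/T}` is integrable and its integral is at most `(a κ₂ + b κ₆) ∫ e^{-H/T}` (`a, b ≥ 0`),
with the one-site moment ratios `κ₂, κ₆`. [folklore] -/
theorem pinnedChain_integral_quadSext_le (N : ℕ) (k : Fin N) {a b : ℝ} (ha : 0 ≤ a) (hb : 0 ≤ b) :
    Integrable (fun x : PhaseSpace N => (a * x.1 k ^ 2 + b * x.1 k ^ 6) * (pinnedChain ω₂ lam β γ).gibbsDensity N T x) ∧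
    ∫ x : PhaseSpace N, (a * x.1 k ^ 2 + b * x.1 k ^ 6) * (pinnedChain ω₂ lam β γ).gibbsDensity N T x ≤
      (a * ((∫⁻ s, ENNReal.ofReal (s ^ (2 * 1)) * ENNReal.ofReal (Real.exp (-(pinnedChain ω₂ lam β γ).U s / T))) /
              ∫⁻ s, ENNReal.ofReal (Real.exp (-(pinnedChain ω₂ lam β γ).U s / T))).toReal +
        b * ((∫⁻ s, ENNReal.ofReal (s ^ (2 * 3)) * ENNReal.ofReal (Real.exp (-(pinnedChain ω₂ lam β γ).U s / T))) /
              ∫⁻ s, ENNReal.ofReal (Real.exp (-(pinnedChain ω₂ lam β γ).U s / T))).toReal) *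
        ∫ x : PhaseSpace N, (pinnedChain ω₂ lam β γ).gibbsDensity N T x := by
  set P := pinnedChain ω₂ lam β γ with hP
  have h2 := pinnedChain_integral_coord_pow_mul_gibbsDensity_le hω hl hβ γ hT N k 1
  have h6 := pinnedChain_integral_coord_pow_mul_gibbsDensity_le hω hl hβ γ hT N k 3
  simp only [show 2 * 1 = 2 from rfl, show 2 * 3 = 6 from rfl] at h2 h6 ⊢
  have hqc : ∀ n : ℕ, Continuous fun x : PhaseSpace N => x.1 k ^ n := fun n => ((continuous_apply k).comp continuous_fst).pow n
  have hI2 : Integrable fun x : PhaseSpace N => x.1 k ^ 2 * P.gibbsDensity N T x := by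
    refine pinnedChain_integrable_mul_gibbsDensity_of_le_pow_four hω hl hβ γ N hT (hqc 2) (C := 2 * ω₂⁻¹) fun x => ?_
    rw [abs_of_nonneg (sq_nonneg _)]
    have := (pinnedChain_coord_pow_le hω hl hβ γ N x k).1
    have hH0 : 0 ≤ P.hamiltonian N x := pinnedChain_hamiltonian_nonneg hω.le hl hβ γ N x
    refine this.trans (mul_le_mul_of_nonneg_left ?_ (by positivity))
    nlinarith [pow_le_pow_right₀ (show (1:ℝ) ≤ 1 + P.hamiltonian N x by linarith) (show 1 ≤ 4 by norm_num)]
  have hI6 : Integrable fun x : PhaseSpace N => x.1 k ^ 6 * P.gibbsDensity N T x := by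
    refine pinnedChain_integrable_mul_gibbsDensity_of_le_pow_four hω hl hβ γ N hT (hqc 6) (C := (2 * ω₂⁻¹) ^ 3) fun x => ?_
    rw [abs_of_nonneg (by positivity)]
    exact (pinnedChain_coord_pow_le hω hl hβ γ N x k).2
  have hsplit : (fun x : PhaseSpace N => (a * x.1 k ^ 2 + b * x.1 k ^ 6) * P.gibbsDensity N T x) =
      fun x => a * (x.1 k ^ 2 * P.gibbsDensity N T x) + b * (x.1 k ^ 6 * P.gibbsDensity N T x) := by
    funext x; ring
  rw [hsplit]
  refine ⟨(hI2.const_mul a).add (hI6.const_mul b), ?_⟩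
  rw [integral_add (hI2.const_mul a) (hI6.const_mul b), integral_const_mul, integral_const_mul, add_mul, mul_assoc,
    mul_assoc]
  exact add_le_add (mul_le_mul_of_nonneg_left h2 ha) (mul_le_mul_of_nonneg_left h6 hb)

/-- **The force second moment is `N`-uniformly bounded**: for every `N` and site `i`,
`∫ (∂_iH)² e^{-H/T} ≤ K ∫ e^{-H/T}` with `K = (6ω₂²+48)κ₂ + (6lam²+768β²)κ₆` (one-site moment ratios `κ₂, κ₆`).
[folklore] -/
theorem pinnedChain_integral_force_sq_le (N : ℕ) (i : Fin N) :
    ∫ x : PhaseSpace N, (pinnedChain ω₂ lam β γ).dPotential N i x.1 ^ 2 * (pinnedChain ω₂ lam β γ).gibbsDensity N T x ≤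
      ((6 * ω₂ ^ 2 + 48) * ((∫⁻ s, ENNReal.ofReal (s ^ (2 * 1)) * ENNReal.ofReal (Real.exp (-(pinnedChain ω₂ lam β γ).U s / T))) /
              ∫⁻ s, ENNReal.ofReal (Real.exp (-(pinnedChain ω₂ lam β γ).U s / T))).toReal +
        (6 * lam ^ 2 + 768 * β ^ 2) * ((∫⁻ s, ENNReal.ofReal (s ^ (2 * 3)) * ENNReal.ofReal (Real.exp (-(pinnedChain ω₂ lam β γ).U s / T))) /
              ∫⁻ s, ENNReal.ofReal (Real.exp (-(pinnedChain ω₂ lam β γ).U s / T))).toReal) *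
        ∫ x : PhaseSpace N, (pinnedChain ω₂ lam β γ).gibbsDensity N T x := by
  set P := pinnedChain ω₂ lam β γ with hP
  set κ₂ : ℝ := ((∫⁻ s, ENNReal.ofReal (s ^ (2 * 1)) * ENNReal.ofReal (Real.exp (-P.U s / T))) /
              ∫⁻ s, ENNReal.ofReal (Real.exp (-P.U s / T))).toReal with hκ₂
  set κ₆ : ℝ := ((∫⁻ s, ENNReal.ofReal (s ^ (2 * 3)) * ENNReal.ofReal (Real.exp (-P.U s / T))) /
              ∫⁻ s, ENNReal.ofReal (Real.exp (-P.U s / T))).toReal with hκ₆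
  set Z : ℝ := ∫ x : PhaseSpace N, P.gibbsDensity N T x with hZ
  set ρ := P.gibbsDensity N T with hρ
  have hκ₂0 : 0 ≤ κ₂ := ENNReal.toReal_nonneg
  have hκ₆0 : 0 ≤ κ₆ := ENNReal.toReal_nonneg
  have hZ0 : 0 ≤ Z := integral_nonneg fun x => (P.gibbsDensity_pos N T x).le
  -- the pointwise majorant and its pieces
  have hsite := fun (k : Fin N) (a b : ℝ) (ha : 0 ≤ a) (hb : 0 ≤ b) =>
    pinnedChain_integral_quadSext_le hω hl hβ γ hT N k ha hb
  set g₀ : PhaseSpace N → ℝ := fun x => ((6 * ω₂ ^ 2 + 24) * x.1 i ^ 2 + (6 * lam ^ 2 + 384 * β ^ 2) * x.1 i ^ 6) * ρ x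
    with hg₀def
  set g₁ : PhaseSpace N → ℝ := fun x => ∑ a : Fin N, if i.val = a.val + 1 then (12 * x.1 a ^ 2 + 192 * β ^ 2 * x.1 a ^ 6) * ρ x else 0
    with hg₁def
  set g₂ : PhaseSpace N → ℝ := fun x => ∑ l : Fin N, if l.val = i.val + 1 then (12 * x.1 l ^ 2 + 192 * β ^ 2 * x.1 l ^ 6) * ρ x else 0
    with hg₂def
  have hg₀ := hsite i (6 * ω₂ ^ 2 + 24) (6 * lam ^ 2 + 384 * β ^ 2) (by positivity) (by positivity)
  have hga : ∀ a : Fin N, Integrable (fun x : PhaseSpace N =>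
      if i.val = a.val + 1 then (12 * x.1 a ^ 2 + 192 * β ^ 2 * x.1 a ^ 6) * ρ x else 0) ∧
      ∫ x : PhaseSpace N, (if i.val = a.val + 1 then (12 * x.1 a ^ 2 + 192 * β ^ 2 * x.1 a ^ 6) * ρ x else 0) ≤
        (if i.val = a.val + 1 then (1:ℝ) else 0) * ((12 * κ₂ + 192 * β ^ 2 * κ₆) * Z) := by
    intro a
    by_cases h : i.val = a.val + 1
    · simp only [if_pos h, one_mul]
      exact hsite a 12 (192 * β ^ 2) (by norm_num) (by positivity)
    · simp only [if_neg h, zero_mul]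
      exact ⟨integrable_zero _ _ _, by simp⟩
  have hgl : ∀ l : Fin N, Integrable (fun x : PhaseSpace N =>
      if l.val = i.val + 1 then (12 * x.1 l ^ 2 + 192 * β ^ 2 * x.1 l ^ 6) * ρ x else 0) ∧
      ∫ x : PhaseSpace N, (if l.val = i.val + 1 then (12 * x.1 l ^ 2 + 192 * β ^ 2 * x.1 l ^ 6) * ρ x else 0) ≤
        (if l.val = i.val + 1 then (1:ℝ) else 0) * ((12 * κ₂ + 192 * β ^ 2 * κ₆) * Z) := by
    intro l
    by_cases h : l.val = i.val + 1
    · simp only [if_pos h, one_mul]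
      exact hsite l 12 (192 * β ^ 2) (by norm_num) (by positivity)
    · simp only [if_neg h, zero_mul]
      exact ⟨integrable_zero _ _ _, by simp⟩
  have hIg₀ : Integrable g₀ := hg₀.1
  have hIg₁ : Integrable g₁ := integrable_finsetSum _ fun a _ => (hga a).1
  have hIg₂ : Integrable g₂ := integrable_finsetSum _ fun l _ => (hgl l).1
  have hbd₁ : ∫ x, g₁ x ≤ (12 * κ₂ + 192 * β ^ 2 * κ₆) * Z := by
    rw [hg₁def, integral_finsetSum _ fun a _ => (hga a).1]
    calc ∑ a : Fin N, ∫ x : PhaseSpace N, (if i.val = a.val + 1 then (12 * x.1 a ^ 2 + 192 * β ^ 2 * x.1 a ^ 6) * ρ x else 0)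
        ≤ ∑ a : Fin N, (if i.val = a.val + 1 then (1:ℝ) else 0) * ((12 * κ₂ + 192 * β ^ 2 * κ₆) * Z) :=
          Finset.sum_le_sum fun a _ => (hga a).2
      _ = (∑ a : Fin N, (if i.val = a.val + 1 then (1:ℝ) else 0)) * ((12 * κ₂ + 192 * β ^ 2 * κ₆) * Z) := by
          rw [Finset.sum_mul]
      _ ≤ 1 * ((12 * κ₂ + 192 * β ^ 2 * κ₆) * Z) :=
          mul_le_mul_of_nonneg_right (sum_ite_succ_left_le_one i) (by positivity)
      _ = _ := one_mul _
  have hbd₂ : ∫ x, g₂ x ≤ (12 * κ₂ + 192 * β ^ 2 * κ₆) * Z := by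
    rw [hg₂def, integral_finsetSum _ fun l _ => (hgl l).1]
    calc ∑ l : Fin N, ∫ x : PhaseSpace N, (if l.val = i.val + 1 then (12 * x.1 l ^ 2 + 192 * β ^ 2 * x.1 l ^ 6) * ρ x else 0)
        ≤ ∑ l : Fin N, (if l.val = i.val + 1 then (1:ℝ) else 0) * ((12 * κ₂ + 192 * β ^ 2 * κ₆) * Z) :=
          Finset.sum_le_sum fun l _ => (hgl l).2
      _ = (∑ l : Fin N, (if l.val = i.val + 1 then (1:ℝ) else 0)) * ((12 * κ₂ + 192 * β ^ 2 * κ₆) * Z) := by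
          rw [Finset.sum_mul]
      _ ≤ 1 * ((12 * κ₂ + 192 * β ^ 2 * κ₆) * Z) :=
          mul_le_mul_of_nonneg_right (sum_ite_succ_right_le_one i) (by positivity)
      _ = _ := one_mul _
  -- integrability of the left-hand side
  obtain ⟨A, hA0, hA⟩ := (pinnedChain_isConfining hω hl hβ le_rfl : (pinnedChain ω₂ lam β 0).IsConfining).exists_abs_deriv_U_le
  obtain ⟨B, hB0, hB⟩ := (pinnedChain_isConfining hω hl hβ le_rfl : (pinnedChain ω₂ lam β 0).IsConfining).exists_abs_deriv_V_le
  have hGb : ∀ x : PhaseSpace N, |P.dPotential N i x.1| ≤ (A + N ^ 2 * B) * (1 + P.hamiltonian N x) := fun x =>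
    (pinnedChain ω₂ lam β 0).abs_dPotential_le hA0 hB0 hA hB
      (fun q => by show 0 ≤ ω₂ * q ^ 2 / 2 + lam * q ^ 4 / 4; positivity)
      (fun r => by show 0 ≤ r ^ 2 / 2 + β * r ^ 4 / 4; positivity) N x i
  have hGc : Continuous fun x : PhaseSpace N => P.dPotential N i x.1 :=
    (P.contDiff_dPotential (pinnedChain_contDiff_U ω₂ lam β γ) (pinnedChain_contDiff_V ω₂ lam β γ) N i).continuous.comp
      continuous_fst
  have hIG : Integrable fun x => P.dPotential N i x.1 ^ 2 * ρ x := by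
    refine pinnedChain_integrable_mul_gibbsDensity_of_le hω hl hβ γ N hT (hGc.pow 2) (C := (A + N ^ 2 * B) ^ 2) fun x => ?_
    rw [abs_pow, ← mul_pow]
    exact pow_le_pow_left₀ (abs_nonneg _) (hGb x) 2
  -- integrate the pointwise bound
  have hρ0 : ∀ x, 0 ≤ ρ x := fun x => (P.gibbsDensity_pos N T x).le
  have hpt : ∀ x, P.dPotential N i x.1 ^ 2 * ρ x ≤ g₀ x + g₁ x + g₂ x := by
    intro x
    have h := mul_le_mul_of_nonneg_right (pinnedChain_dPotential_sq_le ω₂ lam β γ x.1 i) (hρ0 x)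
    refine h.trans (le_of_eq ?_)
    simp only [hg₀def, hg₁def, hg₂def, add_mul, Finset.sum_mul]
    congr 1
    · congr 1
      exact Finset.sum_congr rfl fun a _ => by split_ifs <;> ring
    · exact Finset.sum_congr rfl fun l _ => by split_ifs <;> ring
  have hg₀2 : ∫ x, g₀ x ≤ ((6 * ω₂ ^ 2 + 24) * κ₂ + (6 * lam ^ 2 + 384 * β ^ 2) * κ₆) * Z := hg₀.2
  calc ∫ x, P.dPotential N i x.1 ^ 2 * ρ x ≤ ∫ x, (g₀ x + g₁ x + g₂ x) := integral_mono hIG ((hIg₀.add hIg₁).add hIg₂) hpt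
    _ = (∫ x, g₀ x) + (∫ x, g₁ x) + ∫ x, g₂ x := by
        rw [integral_add (f := fun x => g₀ x + g₁ x) (g := g₂) (hIg₀.add hIg₁) hIg₂,
          integral_add (f := g₀) (g := g₁) hIg₀ hIg₁]
    _ ≤ ((6 * ω₂ ^ 2 + 24) * κ₂ + (6 * lam ^ 2 + 384 * β ^ 2) * κ₆) * Z +
          (12 * κ₂ + 192 * β ^ 2 * κ₆) * Z + (12 * κ₂ + 192 * β ^ 2 * κ₆) * Z := add_le_add (add_le_add hg₀2 hbd₁) hbd₂
    _ = ((6 * ω₂ ^ 2 + 48) * κ₂ + (6 * lam ^ 2 + 768 * β ^ 2) * κ₆) * Z := by ring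

end Assembly

section Main

variable {ω₂ lam β : ℝ} (hω : 0 < ω₂) (hl : 0 ≤ lam) (hβ : 0 ≤ β) (γ : ℝ) {T : ℝ} (hT : 0 < T)
include hω hl hβ hT

omit hω hl hT in
/-- At an interior site `k+1` of an `(n+3)`-site chain the momentum coefficient of the current has the closed form
`-(V'(q_{k+1} - q_k) + V'(q_{k+2} - q_{k+1}))/2`, hence `c_{k+1}² ≥ (q_{k+2} - q_k)²/4`. [folklore] -/
theorem pinnedChain_interior_coeff_sq_ge (n : ℕ) (x : PhaseSpace (n + 3)) (k : Fin (n + 1)) :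
    (x.1 ⟨k.val + 2, by omega⟩ - x.1 ⟨k.val, by omega⟩) ^ 2 / 4 ≤
      ((∑ j : Fin (n + 3), if j.val = (⟨k.val + 1, by omega⟩ : Fin (n + 3)).val + 1 then
          -(deriv (pinnedChain ω₂ lam β γ).V (x.1 j - x.1 ⟨k.val + 1, by omega⟩)) / 2 else 0) +
        ∑ i : Fin (n + 3), if (⟨k.val + 1, by omega⟩ : Fin (n + 3)).val = i.val + 1 then
          -(deriv (pinnedChain ω₂ lam β γ).V (x.1 ⟨k.val + 1, by omega⟩ - x.1 i)) / 2 else 0) ^ 2 := by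
  set P := pinnedChain ω₂ lam β γ with hP
  have h1 : (∑ j : Fin (n + 3), if j.val = (⟨k.val + 1, by omega⟩ : Fin (n + 3)).val + 1 then
      -(deriv P.V (x.1 j - x.1 ⟨k.val + 1, by omega⟩)) / 2 else 0) =
      -(deriv P.V (x.1 ⟨k.val + 2, by omega⟩ - x.1 ⟨k.val + 1, by omega⟩)) / 2 := by
    rw [Finset.sum_eq_single (⟨k.val + 2, by omega⟩ : Fin (n + 3))]
    · simp
    · intro b _ hb
      rw [if_neg]
      intro h
      exact hb (Fin.ext (by simp at h ⊢; omega))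
    · intro h; exact absurd (Finset.mem_univ _) h
  have h2 : (∑ i : Fin (n + 3), if (⟨k.val + 1, by omega⟩ : Fin (n + 3)).val = i.val + 1 then
      -(deriv P.V (x.1 ⟨k.val + 1, by omega⟩ - x.1 i)) / 2 else 0) =
      -(deriv P.V (x.1 ⟨k.val + 1, by omega⟩ - x.1 ⟨k.val, by omega⟩)) / 2 := by
    rw [Finset.sum_eq_single (⟨k.val, by omega⟩ : Fin (n + 3))]
    · simp
    · intro b _ hb
      rw [if_neg]
      intro h
      exact hb (Fin.ext (by simp at h ⊢; omega))
    · intro h; exact absurd (Finset.mem_univ _) h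
  rw [h1, h2]
  have key := sq_neighbour_dist_le_coeff_sq hβ ω₂ lam γ (x.1 ⟨k.val, by omega⟩) (x.1 ⟨k.val + 2, by omega⟩)
    (x.1 ⟨k.val + 1, by omega⟩)
  have e : -(deriv P.V (x.1 ⟨k.val + 2, by omega⟩ - x.1 ⟨k.val + 1, by omega⟩)) / 2 +
      -(deriv P.V (x.1 ⟨k.val + 1, by omega⟩ - x.1 ⟨k.val, by omega⟩)) / 2 =
      -(deriv P.V (x.1 ⟨k.val + 1, by omega⟩ - x.1 ⟨k.val, by omega⟩) +
        deriv P.V (x.1 ⟨k.val + 2, by omega⟩ - x.1 ⟨k.val + 1, by omega⟩)) / 2 := by ring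
  rw [e]
  exact key

/-- **Extensivity of the current's norm, abstract force constant**: if `∫ (∂_iH)² e^{-H/T} ≤ K ∫ e^{-H/T}` for every
site `i` of the `(n+3)`-site pinned chain, then `K > 0` and `(T³/(4K)) (n+1) ∫ e^{-H/T} ≤ ∫ J² e^{-H/T}`.
Mechanism: `∫J² = T∑_m∫c_m²` (Gaussian integration by parts), `c_{k+1}² ≥ (q_{k+2}-q_k)²/4`, and
`∫(q_{k+2}-q_k)² ≥ T² Z/K` (position integration by parts + Cauchy–Schwarz). [folklore] -/
theorem pinnedChain_integral_totalCurrent_sq_ge_of_force (n : ℕ) {K : ℝ}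
    (hforce : ∀ i : Fin (n + 3), ∫ x : PhaseSpace (n + 3), (pinnedChain ω₂ lam β γ).dPotential (n + 3) i x.1 ^ 2 *
        (pinnedChain ω₂ lam β γ).gibbsDensity (n + 3) T x ≤ K * ∫ x : PhaseSpace (n + 3), (pinnedChain ω₂ lam β γ).gibbsDensity (n + 3) T x) :
    0 < K ∧ T ^ 3 / (4 * K) * (n + 1) * ∫ x : PhaseSpace (n + 3), (pinnedChain ω₂ lam β γ).gibbsDensity (n + 3) T x ≤
      ∫ x : PhaseSpace (n + 3), (∑ i, (pinnedChain ω₂ lam β γ).bondCurrent (n + 3) i x) ^ 2 *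
        (pinnedChain ω₂ lam β γ).gibbsDensity (n + 3) T x := by
  let P := pinnedChain ω₂ lam β γ
  let ρ : PhaseSpace (n + 3) → ℝ := P.gibbsDensity (n + 3) T
  let Z : ℝ := ∫ x : PhaseSpace (n + 3), ρ x
  have hρi : Integrable ρ := pinnedChain_integrable_gibbsDensity hω hl hβ γ (n + 3) hT
  have hZpos : 0 < Z := integral_exp_pos hρi
  let c : Fin (n + 3) → PhaseSpace (n + 3) → ℝ := fun m x =>
    (∑ j : Fin (n + 3), if j.val = m.val + 1 then -(deriv P.V (x.1 j - x.1 m)) / 2 else 0) +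
      ∑ i : Fin (n + 3), if m.val = i.val + 1 then -(deriv P.V (x.1 m - x.1 i)) / 2 else 0
  have hM : ∫ x, (∑ i, P.bondCurrent (n + 3) i x) ^ 2 * ρ x = T * ∫ x, (∑ m, c m x ^ 2) * ρ x :=
    pinnedChain_integral_totalCurrent_sq_eq hω hl hβ γ (n + 3) hT
  have hIc : ∀ m, Integrable fun x => c m x ^ 2 * ρ x := fun m => pinnedChain_integrable_coeff_sq hω hl hβ γ (n + 3) hT m
  -- per interior site: spread bound
  have hsite : ∀ k : Fin (n + 1), 0 < K ∧ T ^ 2 * Z / K / 4 ≤ ∫ x, c ⟨k.val + 1, by omega⟩ x ^ 2 * ρ x := by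
    intro k
    let i0 : Fin (n + 3) := ⟨k.val, by omega⟩
    let i2 : Fin (n + 3) := ⟨k.val + 2, by omega⟩
    have hne : i2 ≠ i0 := fun h => by simp [i0, i2, Fin.ext_iff] at h
    have hCS := pinnedChain_sq_mass_le_spread_mul_force hω hl hβ γ (n + 3) hT i2 i0 hne
    have hY := hforce i2
    have hX0 : 0 ≤ ∫ x : PhaseSpace (n + 3), (x.1 i2 - x.1 i0) ^ 2 * ρ x :=
      integral_nonneg fun x => mul_nonneg (sq_nonneg _) (P.gibbsDensity_pos _ T x).le
    have hY0 : 0 ≤ ∫ x : PhaseSpace (n + 3), P.dPotential (n + 3) i2 x.1 ^ 2 * ρ x :=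
      integral_nonneg fun x => mul_nonneg (sq_nonneg _) (P.gibbsDensity_pos _ T x).le
    have hTZ : 0 < T * Z := mul_pos hT hZpos
    -- `(TZ)² ≤ X·Y`, `Y ≤ K Z`  ⟹  `Y > 0`, `K > 0`, `X ≥ T² Z / K`
    have hYpos : 0 < ∫ x : PhaseSpace (n + 3), P.dPotential (n + 3) i2 x.1 ^ 2 * ρ x := by
      rcases hY0.lt_or_eq with h | h
      · exact h
      · exfalso; rw [← h, mul_zero] at hCS; nlinarith
    have hKpos : 0 < K := by
      by_contra hK
      push Not at hK
      have : K * Z ≤ 0 := mul_nonpos_of_nonpos_of_nonneg hK hZpos.le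
      linarith
    have hXge : T ^ 2 * Z / K ≤ ∫ x : PhaseSpace (n + 3), (x.1 i2 - x.1 i0) ^ 2 * ρ x := by
      rw [div_le_iff₀ hKpos]
      have h1 := hCS.trans (mul_le_mul_of_nonneg_left hY hX0)
      have h2 : (T * Z) ^ 2 = (T ^ 2 * Z) * Z := by ring
      rw [h2] at h1
      have h3 : (∫ x : PhaseSpace (n + 3), (x.1 i2 - x.1 i0) ^ 2 * ρ x) * (K * Z) =
          ((∫ x : PhaseSpace (n + 3), (x.1 i2 - x.1 i0) ^ 2 * ρ x) * K) * Z := by ring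
      rw [h3] at h1
      exact le_of_mul_le_mul_right h1 hZpos
    -- pointwise: `c² ≥ (q_{k+2} - q_k)²/4`
    have hIX : Integrable fun x : PhaseSpace (n + 3) => (x.1 i2 - x.1 i0) ^ 2 / 4 * ρ x := by
      have hdc : Continuous fun x : PhaseSpace (n + 3) => (x.1 i2 - x.1 i0) ^ 2 / 4 :=
        ((((continuous_apply i2).comp continuous_fst).sub ((continuous_apply i0).comp continuous_fst)).pow 2).div_const 4
      refine pinnedChain_integrable_mul_gibbsDensity_of_le hω hl hβ γ (n + 3) hT hdc (C := (2 * (1 + ω₂⁻¹)) ^ 2) fun x => ?_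
      have hb : |x.1 i2 - x.1 i0| ≤ 2 * (1 + ω₂⁻¹) * (1 + P.hamiltonian (n + 3) x) := by
        calc |x.1 i2 - x.1 i0| ≤ |x.1 i2| + |x.1 i0| := abs_sub _ _
          _ ≤ (1 + ω₂⁻¹) * (1 + P.hamiltonian (n + 3) x) + (1 + ω₂⁻¹) * (1 + P.hamiltonian (n + 3) x) :=
              add_le_add (pinnedChain_abs_coord_le hω hl hβ γ (n + 3) x i2) (pinnedChain_abs_coord_le hω hl hβ γ (n + 3) x i0)
          _ = 2 * (1 + ω₂⁻¹) * (1 + P.hamiltonian (n + 3) x) := by ring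
      rw [abs_of_nonneg (by positivity)]
      have hsq : (x.1 i2 - x.1 i0) ^ 2 ≤ (2 * (1 + ω₂⁻¹) * (1 + P.hamiltonian (n + 3) x)) ^ 2 := by
        rw [← sq_abs]; exact pow_le_pow_left₀ (abs_nonneg _) hb 2
      nlinarith [sq_nonneg (2 * (1 + ω₂⁻¹) * (1 + P.hamiltonian (n + 3) x))]
    have hpt : ∀ x : PhaseSpace (n + 3), (x.1 i2 - x.1 i0) ^ 2 / 4 * ρ x ≤ c ⟨k.val + 1, by omega⟩ x ^ 2 * ρ x := by
      intro x
      refine mul_le_mul_of_nonneg_right ?_ (P.gibbsDensity_pos _ T x).le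
      exact pinnedChain_interior_coeff_sq_ge hβ γ n x k
    have hint : ∫ x : PhaseSpace (n + 3), (x.1 i2 - x.1 i0) ^ 2 / 4 * ρ x =
        (∫ x : PhaseSpace (n + 3), (x.1 i2 - x.1 i0) ^ 2 * ρ x) / 4 := by
      rw [← integral_div]
      exact integral_congr_ae (Filter.Eventually.of_forall fun x => by ring)
    refine ⟨hKpos, ?_⟩
    calc T ^ 2 * Z / K / 4 ≤ (∫ x : PhaseSpace (n + 3), (x.1 i2 - x.1 i0) ^ 2 * ρ x) / 4 := by gcongr
      _ = ∫ x : PhaseSpace (n + 3), (x.1 i2 - x.1 i0) ^ 2 / 4 * ρ x := hint.symm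
      _ ≤ ∫ x, c ⟨k.val + 1, by omega⟩ x ^ 2 * ρ x := by
          refine integral_mono hIX (hIc ⟨k.val + 1, by omega⟩) ?_
          intro x
          exact hpt x
  have hKpos : 0 < K := (hsite 0).1
  refine ⟨hKpos, ?_⟩
  -- sum over the interior sites
  let e : Fin (n + 1) ↪ Fin (n + 3) := ⟨fun k => ⟨k.val + 1, by omega⟩, fun a b h => by
    simp [Fin.ext_iff] at h; exact Fin.ext h⟩
  have hsum : ∑ k : Fin (n + 1), ∫ x, c (e k) x ^ 2 * ρ x ≤ ∑ m : Fin (n + 3), ∫ x, c m x ^ 2 * ρ x := by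
    rw [← Finset.sum_map (Finset.univ) e (fun m => ∫ x, c m x ^ 2 * ρ x)]
    exact Finset.sum_le_sum_of_subset_of_nonneg (Finset.subset_univ _) fun m _ _ =>
      integral_nonneg fun x => mul_nonneg (sq_nonneg _) (P.gibbsDensity_pos _ T x).le
  have hlow : (n + 1 : ℝ) * (T ^ 2 * Z / K / 4) ≤ ∑ k : Fin (n + 1), ∫ x, c (e k) x ^ 2 * ρ x := by
    have : ∑ _k : Fin (n + 1), (T ^ 2 * Z / K / 4) ≤ ∑ k : Fin (n + 1), ∫ x, c (e k) x ^ 2 * ρ x :=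
      Finset.sum_le_sum fun k _ => (hsite k).2
    simpa [Finset.sum_const, Finset.card_univ, Fintype.card_fin] using this
  have hswap : ∫ x, (∑ m, c m x ^ 2) * ρ x = ∑ m : Fin (n + 3), ∫ x, c m x ^ 2 * ρ x := by
    rw [← integral_finsetSum _ fun m _ => hIc m]
    exact integral_congr_ae (Filter.Eventually.of_forall fun x => by simp only [Finset.sum_mul])
  rw [hM, hswap]
  calc T ^ 3 / (4 * K) * (n + 1) * Z = T * ((n + 1 : ℝ) * (T ^ 2 * Z / K / 4)) := by
        field_simp
    _ ≤ T * ∑ k : Fin (n + 1), ∫ x, c (e k) x ^ 2 * ρ x := mul_le_mul_of_nonneg_left hlow hT.le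
    _ ≤ T * ∑ m : Fin (n + 3), ∫ x, c m x ^ 2 * ρ x := mul_le_mul_of_nonneg_left hsum hT.le

/-- **Extensivity of the current's norm** (the static input of bath locality): for the pinned chain
(`ω₂ > 0`, `lam, β ≥ 0`, `T > 0`) and every `N = n + 3 ≥ 3`,
`(T³/(4K)) (N - 2) ∫ e^{-H/T} ≤ ∫ J² e^{-H/T}` with the `N`-free force constant
`K = (6ω₂²+48)κ₂ + (6lam²+768β²)κ₆ > 0` of `pinnedChain_integral_force_sq_le`. [folklore] -/
theorem pinnedChain_integral_totalCurrent_sq_ge (n : ℕ) :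
    0 < ((6 * ω₂ ^ 2 + 48) * ((∫⁻ s, ENNReal.ofReal (s ^ (2 * 1)) * ENNReal.ofReal (Real.exp (-(pinnedChain ω₂ lam β γ).U s / T))) /
              ∫⁻ s, ENNReal.ofReal (Real.exp (-(pinnedChain ω₂ lam β γ).U s / T))).toReal +
        (6 * lam ^ 2 + 768 * β ^ 2) * ((∫⁻ s, ENNReal.ofReal (s ^ (2 * 3)) * ENNReal.ofReal (Real.exp (-(pinnedChain ω₂ lam β γ).U s / T))) /
              ∫⁻ s, ENNReal.ofReal (Real.exp (-(pinnedChain ω₂ lam β γ).U s / T))).toReal) ∧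
    T ^ 3 / (4 * ((6 * ω₂ ^ 2 + 48) * ((∫⁻ s, ENNReal.ofReal (s ^ (2 * 1)) * ENNReal.ofReal (Real.exp (-(pinnedChain ω₂ lam β γ).U s / T))) /
              ∫⁻ s, ENNReal.ofReal (Real.exp (-(pinnedChain ω₂ lam β γ).U s / T))).toReal +
        (6 * lam ^ 2 + 768 * β ^ 2) * ((∫⁻ s, ENNReal.ofReal (s ^ (2 * 3)) * ENNReal.ofReal (Real.exp (-(pinnedChain ω₂ lam β γ).U s / T))) /
              ∫⁻ s, ENNReal.ofReal (Real.exp (-(pinnedChain ω₂ lam β γ).U s / T))).toReal)) * (n + 1) *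
        ∫ x : PhaseSpace (n + 3), (pinnedChain ω₂ lam β γ).gibbsDensity (n + 3) T x ≤
      ∫ x : PhaseSpace (n + 3), (∑ i, (pinnedChain ω₂ lam β γ).bondCurrent (n + 3) i x) ^ 2 *
        (pinnedChain ω₂ lam β γ).gibbsDensity (n + 3) T x :=
  pinnedChain_integral_totalCurrent_sq_ge_of_force hω hl hβ γ hT n
    (fun i => pinnedChain_integral_force_sq_le hω hl hβ γ hT (n + 3) i)

end Main

end Summit.AtomisticToContinuum.FouriersLaw.Theorems.ChainVariation

end
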